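import Literature.Probability.LatticeModels.RCRealize
import HarnessLib

/-!
# Random-cluster contours, IX: the contour representation of the partition functions

Topic `Literature/Probability/LatticeModels`. The external-contour representation of the random-cluster
partition functions of a volume (Friedli–Velenik 2017, §7.3, eqs. (7.29)–(7.30); Grimmett 2006, §7.5,
eqs. (7.21)–(7.22)), obtained by summing the weights `wt t q σ V ω = t^{E_V(ω)} q^{κ^σ_V(ω)}` of `RCWeights`
over the fibres of the bijection of `RCRealize`:

* `sum_powerset_biUnion_prod` — sums over configurations of pairwise disjoint edge blocks factorise;
* `wt_glue` — the weight of a glued configuration is `w_σ^{|V ∖ ⋃ hull|} Π_{γ ∈ Γ} (t^{e(γ)} q^{cwt(γ)}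
  Π_{A ∈ ints γ} wt^{lab A}_A(U ∩ freeEdges A))` (energy and cluster-count decompositions), with the ground
  weights `groundW`: `t^{2d}` per site for `ord`, `q` per site for `dis`;
* `sum_Fib_wt` — **the fibre sum**: the total weight of the configurations with external contours `Γ` is
  `w_σ^{|V ∖ ⋃ hull|} Π_{γ ∈ Γ} ( t^{e(γ)} q^{cwt(γ)} Π_{A ∈ ints γ} Z^{lab A}(A) )`;
* `Zrc_eq_sum_extFam` — **`Z^σ(V) = Σ_{Γ ∈ ExtFam σ V} (fibre sum of Γ)`**, the contour representation
  (the `Rec` input of the Pirogov–Sinai engine `PSStability`, up to the normalisation done in the model file);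
* `sum_wt_filter_mem_xc` — the total weight of the configurations having a given external contour, as a sum
  of fibre sums (the input of FV Lemma 7.26, `ContourModel.extFam_through_le`).

Everything is proved; no named facts.

## References

* S. Friedli, Y. Velenik, *Statistical Mechanics of Lattice Systems*, CUP 2017, §7.3, eqs. (7.27)–(7.30),
  Lemma 7.26. [FriedliVelenik2017]
* G. Grimmett, *The Random-Cluster Model*, Springer 2006, §7.5, eqs. (7.18)–(7.22), (7.65)–(7.66). [Grimmett2006]
-/

noncomputable section

open Finset Relation

namespace Literature.Probability.LatticeModels

/-! ### A product formula for sums over configurations of disjoint blocks -/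

section BlockProduct

variable {ι α : Type*} [DecidableEq ι] [DecidableEq α]

/-- **Sums over configurations of pairwise disjoint edge blocks factorise**:
`Σ_{U ⊆ ⋃ᵢ Eᵢ} Πᵢ fᵢ(U ∩ Eᵢ) = Πᵢ Σ_{W ⊆ Eᵢ} fᵢ(W)`. [folklore] -/
theorem sum_powerset_biUnion_prod (s : Finset ι) (E : ι → Finset α) (hE : (s : Set ι).PairwiseDisjoint E)
    (f : ι → Finset α → ℝ) :
    ∑ U ∈ (s.biUnion E).powerset, ∏ i ∈ s, f i (U ∩ E i) = ∏ i ∈ s, ∑ W ∈ (E i).powerset, f i W := by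
  induction s using Finset.induction_on with
  | empty => simp
  | insert i s hi ih =>
    have hE' : (s : Set ι).PairwiseDisjoint E := hE.subset (by simp)
    have hdisj : Disjoint (E i) (s.biUnion E) := by
      rw [disjoint_biUnion_right]
      intro j hj
      exact hE (mem_coe.2 (mem_insert_self i s)) (mem_coe.2 (mem_insert_of_mem hj)) (fun h => hi (h ▸ hj))
    have hEj : ∀ j ∈ s, s.biUnion E ∩ E j = E j := fun j hj => inter_eq_right.2 (subset_biUnion_of_mem E hj)
    rw [biUnion_insert, prod_insert hi, ← ih hE']
    simp_rw [prod_insert hi]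
    -- reindex `U ↦ (U ∩ E i, U ∩ ⋃_s E)`
    calc ∑ U ∈ (E i ∪ s.biUnion E).powerset, f i (U ∩ E i) * ∏ j ∈ s, f j (U ∩ E j)
        = ∑ p ∈ (E i).powerset ×ˢ (s.biUnion E).powerset, f i p.1 * ∏ j ∈ s, f j (p.2 ∩ E j) := by
          refine sum_nbij' (fun U => (U ∩ E i, U ∩ s.biUnion E)) (fun p => p.1 ∪ p.2) (fun U _ => ?_) (fun p hp => ?_)
            (fun U hU => ?_) (fun p hp => ?_) (fun U _ => ?_)
          · exact mem_product.2 ⟨mem_powerset.2 inter_subset_right, mem_powerset.2 inter_subset_right⟩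
          · obtain ⟨h1, h2⟩ := mem_product.1 hp
            exact mem_powerset.2 (union_subset_union (mem_powerset.1 h1) (mem_powerset.1 h2))
          · show U ∩ E i ∪ U ∩ s.biUnion E = U
            rw [← inter_union_distrib_left]; exact inter_eq_left.2 (mem_powerset.1 hU)
          · obtain ⟨h1, h2⟩ := mem_product.1 hp
            have h1' := mem_powerset.1 h1; have h2' := mem_powerset.1 h2
            refine Prod.ext ?_ ?_
            · show (p.1 ∪ p.2) ∩ E i = p.1
              rw [union_inter_distrib_right, inter_eq_left.2 h1', disjoint_iff_inter_eq_empty.1 (hdisj.symm.mono_left h2'), union_empty]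
            · show (p.1 ∪ p.2) ∩ s.biUnion E = p.2
              rw [union_inter_distrib_right, inter_eq_left.2 h2', disjoint_iff_inter_eq_empty.1 (hdisj.mono_left h1'), empty_union]
          · show f i (U ∩ E i) * ∏ j ∈ s, f j (U ∩ E j) = f i (U ∩ E i) * ∏ j ∈ s, f j (U ∩ s.biUnion E ∩ E j)
            exact congrArg _ (prod_congr rfl fun j hj => by rw [inter_assoc, hEj j hj])
      _ = (∑ W ∈ (E i).powerset, f i W) * ∑ U ∈ (s.biUnion E).powerset, ∏ j ∈ s, f j (U ∩ E j) := by
          rw [sum_product, sum_mul_sum]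

end BlockProduct

namespace RCC

open ContourSetup ClassCount

variable {d : ℕ}

/-! ### Weights, ground weights, fibres -/

/-- **The weight of a configuration of the volume `V` with boundary condition `σ`**: `t^{E_V(ω)} q^{κ^σ_V(ω)}`
(the summand of `Zrc`). [cite: Grimmett2006, §7.5, eqs. (7.65)–(7.66)] -/
def wt (t q : ℝ) (σ : Phase) (V : Finset (Site d)) (ω : Finset (Sym2 (Site d))) : ℝ :=
  t ^ energy σ (freeEdges V) ω V * q ^ kappa σ V (freeEdges V) ω

/-- **The ground weight per site** of a phase: `t^{2d}` for `ord` (all `2d` half-edges open, one cluster),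
`q` for `dis` (no open edge, one cluster per site). [cite: FriedliVelenik2017, §7.3, eq. (7.27) (e^{-β e_#})] -/
def groundW (d : ℕ) (t q : ℝ) (σ : Phase) : ℝ := if σ = Phase.ord then t ^ (2 * d) else q

/-- The external contours as a total function of the configuration. [folklore] -/
def xc (σ : Phase) (V : Finset (Site d)) (ω : Finset (Sym2 (Site d))) : Finset (rcSetup d).Γ :=
  if h : ω ⊆ freeEdges V then extContours σ h else ∅

/-- **The fibre of an external family**: the configurations of the volume whose external contours are `Γ`.
[cite: FriedliVelenik2017, §7.3, eq. (7.29)] -/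
def Fib (σ : Phase) (V : Finset (Site d)) (Γ : Finset (rcSetup d).Γ) : Finset (Finset (Sym2 (Site d))) :=
  (freeEdges V).powerset.filter fun ω => xc σ V ω = Γ

/-- `Zrc = Σ_ω wt ω`. [cite: Grimmett2006, §7.5, eq. (7.65)] -/
theorem Zrc_eq_sum_wt (t q : ℝ) (σ : Phase) (V : Finset (Site d)) : Zrc t q σ V = ∑ ω ∈ (freeEdges V).powerset, wt t q σ V ω := rfl

/-- `xc` of a configuration of the volume. [folklore] -/
theorem xc_eq {σ : Phase} {V : Finset (Site d)} {ω : Finset (Sym2 (Site d))} (hω : ω ⊆ freeEdges V) : xc σ V ω = extContours σ hω := by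
  rw [xc, dif_pos hω]

/-- The ground weight is positive for `t, q > 0`. [folklore] -/
theorem groundW_pos {t q : ℝ} (ht : 0 < t) (hq : 0 < q) (σ : Phase) : 0 < groundW d t q σ := by
  rw [groundW]; split_ifs
  · exact pow_pos ht _
  · exact hq

/-! ### The weight of a glued configuration -/

section Glue

variable (hd : 2 ≤ d) {σ : Phase} {V : Finset (Site d)} (hV : StarConn (V : Set (Site d))ᶜ)
  {Γ : Finset (rcSetup d).Γ} (hΓ : Γ ∈ (rcSetup d).ExtFam σ V) {U : Finset (Sym2 (Site d))} (hU : U ⊆ IntEdges Γ)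

include hd hV in
/-- The exterior part of the volume of the glued configuration is `Wvol V Γ`. [cite: FriedliVelenik2017, §7.3 (Λ^ext)] -/
theorem Vext_glue (hΓ : Γ ∈ (rcSetup d).ExtFam σ V) (hU : U ⊆ IntEdges Γ) :
    Vext σ V (glue_subset hd hV hΓ hU) = (rcSetup d).Wvol V Γ := by
  ext x
  rw [Vext, mem_filter, mem_Wvol, extContours_glue hd hV hΓ hU]

/-- The glued configuration meets the free edges of an interior component in `U ∩ freeEdges A`. [folklore] -/
theorem glue_inter_freeEdges {γ : (rcSetup d).Γ} (hγ : γ ∈ Γ) {A : Finset (Site d)} (hA : A ∈ (rcSetup d).ints γ) :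
    glue σ V Γ U ∩ freeEdges A = U ∩ freeEdges A := by
  ext e
  rw [mem_inter, mem_inter, glue, mem_union, mem_base]
  constructor
  · rintro ⟨(⟨⟨-, hI⟩, -⟩ | h), heA⟩
    · exact absurd ((mem_IntEdges).2 ⟨γ, hγ, A, hA, heA⟩) hI
    · exact ⟨h, heA⟩
  · rintro ⟨h, heA⟩; exact ⟨Or.inr h, heA⟩

include hd hV in
/-- **The weight of a glued configuration factorises** over the exterior part, the external contours and the
blocks (the energy and cluster-count decompositions of `RCWeights`/`RCGluing`).
[cite: Grimmett2006, §7.5, eqs. (7.65)–(7.66); FriedliVelenik2017, §7.3.1, eq. (7.28)] -/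
theorem wt_glue (t q : ℝ) (hΓ : Γ ∈ (rcSetup d).ExtFam σ V) (hU : U ⊆ IntEdges Γ) :
    wt t q σ V (glue σ V Γ U) = groundW d t q σ ^ #((rcSetup d).Wvol V Γ) *
      ∏ γ ∈ Γ, (t ^ γ.1.energy * q ^ γ.1.cwt * ∏ A ∈ (rcSetup d).ints γ, wt t q ((rcSetup d).lab γ A) A (U ∩ freeEdges A)) := by
  have hω := glue_subset hd hV hΓ hU
  have hext := extContours_glue hd hV hΓ hU
  have hE := energy_decomposition hd hω hV (σ := σ)
  have hK := kappa_decomposition hd hω hV (σ := σ)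
  rw [hext, Vext_glue hd hV hΓ hU] at hE hK
  have hE' : energy σ (freeEdges V) (glue σ V Γ U) V = (if σ = Phase.ord then 2 * d else 0) * #((rcSetup d).Wvol V Γ) +
      ∑ γ ∈ Γ, (γ.1.energy + ∑ A ∈ (rcSetup d).ints γ, energy ((rcSetup d).lab γ A) (freeEdges A) (U ∩ freeEdges A) A) := by
    rw [hE]
    refine congrArg _ (sum_congr rfl fun γ hγ => congrArg _ (sum_congr rfl fun A hA => ?_))
    rw [glue_inter_freeEdges hγ hA]
  have hK' : kappa σ V (freeEdges V) (glue σ V Γ U) = (if σ = Phase.dis then #((rcSetup d).Wvol V Γ) else 0) +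
      ∑ γ ∈ Γ, (γ.1.cwt + ∑ A ∈ (rcSetup d).ints γ, kappa ((rcSetup d).lab γ A) A (freeEdges A) (U ∩ freeEdges A)) := by
    rw [hK]
    refine congrArg _ (sum_congr rfl fun γ hγ => congrArg _ (sum_congr rfl fun A hA => ?_))
    rw [glue_inter_freeEdges hγ hA]
  unfold wt
  rw [hE', hK', pow_add, pow_add, ← prod_pow_eq_pow_sum, ← prod_pow_eq_pow_sum]
  simp_rw [pow_add, ← prod_pow_eq_pow_sum, prod_mul_distrib]
  have hg : groundW d t q σ ^ #((rcSetup d).Wvol V Γ) =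
      t ^ ((if σ = Phase.ord then 2 * d else 0) * #((rcSetup d).Wvol V Γ)) * q ^ (if σ = Phase.dis then #((rcSetup d).Wvol V Γ) else 0) := by
    cases σ
    · rw [groundW, if_pos rfl, if_pos rfl, if_neg (by decide), pow_zero, mul_one, ← pow_mul]
    · rw [groundW, if_neg (by decide), if_neg (by decide), if_pos rfl, zero_mul, pow_zero, one_mul]
  rw [hg]; ring

end Glue

/-! ### The fibre sum -/

section Fibre

variable (hd : 2 ≤ d) {σ : Phase} {V : Finset (Site d)} (hV : StarConn (V : Set (Site d))ᶜ)

/-- The blocks of a family: pairs (member, interior component). [folklore] -/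
def blocks (Γ : Finset (rcSetup d).Γ) : Finset (Σ _ : (rcSetup d).Γ, Finset (Site d)) := Γ.sigma fun γ => (rcSetup d).ints γ

/-- The interior edges are the union of the free edges of the blocks. [folklore] -/
theorem IntEdges_eq_biUnion_blocks (Γ : Finset (rcSetup d).Γ) : IntEdges Γ = (blocks Γ).biUnion fun p => freeEdges p.2 := by
  ext e
  rw [mem_IntEdges, mem_biUnion]
  constructor
  · rintro ⟨γ, hγ, A, hA, he⟩; exact ⟨⟨γ, A⟩, mem_sigma.2 ⟨hγ, hA⟩, he⟩
  · rintro ⟨⟨γ, A⟩, hp, he⟩; exact ⟨γ, (mem_sigma.1 hp).1, A, (mem_sigma.1 hp).2, he⟩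

include hd in
/-- The free edges of distinct blocks are disjoint. [folklore] -/
theorem pairwiseDisjoint_blocks {Γ : Finset (rcSetup d).Γ} (hΓ : Γ ∈ (rcSetup d).ExtFam σ V) :
    ((blocks Γ : Finset (Σ _ : (rcSetup d).Γ, Finset (Site d))) : Set (Σ _ : (rcSetup d).Γ, Finset (Site d))).PairwiseDisjoint fun p => freeEdges p.2 := by
  rintro ⟨γ, A⟩ hp ⟨γ', A'⟩ hp' hne
  obtain ⟨hγ, hA⟩ := mem_sigma.1 (mem_coe.1 hp)
  obtain ⟨hγ', hA'⟩ := mem_sigma.1 (mem_coe.1 hp')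
  refine Finset.disjoint_left.2 fun e he he' => hne ?_
  induction e using Sym2.ind with
  | h u v =>
    have hE := (mem_freeEdges.1 he).1
    have hu : u ∈ A := inner1_subset A (core_subset_inner1 A ((mem_freeEdges.1 he).2 (mem_coBall_of_mem hE (Sym2.mem_mk_left u v))))
    have hu' : u ∈ A' := inner1_subset A' (core_subset_inner1 A' ((mem_freeEdges.1 he').2 (mem_coBall_of_mem hE (Sym2.mem_mk_left u v))))
    obtain ⟨rfl, rfl⟩ := eq_of_mem_ints_of_mem hΓ hd hγ hγ' hA hA' hu hu'
    rfl

include hd hV in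
/-- **The fibre sum** (FV (7.29)–(7.30) / Grimmett (7.21)–(7.22)): the total weight of the configurations
whose external contours are the family `Γ` is
`w_σ^{|V ∖ ⋃ hull|} Π_{γ ∈ Γ} ( t^{e(γ)} q^{cwt(γ)} Π_{A ∈ ints γ} Z^{lab A}(A) )`.
[cite: FriedliVelenik2017, §7.3, eqs. (7.29)–(7.30); Grimmett2006, §7.5, eqs. (7.21)–(7.22)] -/
theorem sum_Fib_wt (t q : ℝ) {Γ : Finset (rcSetup d).Γ} (hΓ : Γ ∈ (rcSetup d).ExtFam σ V) :
    ∑ ω ∈ Fib σ V Γ, wt t q σ V ω = groundW d t q σ ^ #((rcSetup d).Wvol V Γ) *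
      ∏ γ ∈ Γ, (t ^ γ.1.energy * q ^ γ.1.cwt * ∏ A ∈ (rcSetup d).ints γ, Zrc t q ((rcSetup d).lab γ A) A) := by
  classical
  -- reindex the fibre by the interior edges
  have h1 : ∑ ω ∈ Fib σ V Γ, wt t q σ V ω = ∑ U ∈ (IntEdges Γ).powerset, wt t q σ V (glue σ V Γ U) := by
    have hleft : ∀ ω ∈ Fib σ V Γ, glue σ V Γ (ω ∩ IntEdges Γ) = ω := by
      intro ω hω
      obtain ⟨hωF, hx⟩ := mem_filter.1 hω
      have hωF' := mem_powerset.1 hωF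
      rw [xc_eq hωF'] at hx
      have := glue_extContours hd hV hωF' (σ := σ)
      rwa [hx] at this
    refine sum_nbij' (fun ω => ω ∩ IntEdges Γ) (fun U => glue σ V Γ U) (fun ω _ => mem_powerset.2 inter_subset_right)
      (fun U hU => ?_) hleft (fun U hU => glue_inter_IntEdges (mem_powerset.1 hU)) (fun ω hω => by rw [hleft ω hω])
    have hU' := mem_powerset.1 hU
    refine mem_filter.2 ⟨mem_powerset.2 (glue_subset hd hV hΓ hU'), ?_⟩
    rw [xc_eq (glue_subset hd hV hΓ hU')]
    exact extContours_glue hd hV hΓ hU'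
  rw [h1, sum_congr rfl fun U hU => wt_glue hd hV t q hΓ (mem_powerset.1 hU), ← mul_sum]
  congr 1
  simp_rw [prod_mul_distrib]
  rw [← mul_sum]
  congr 1
  -- the block product
  have hprod : ∀ f : (rcSetup d).Γ → Finset (Site d) → ℝ,
      ∏ γ ∈ Γ, ∏ A ∈ (rcSetup d).ints γ, f γ A = ∏ p ∈ blocks Γ, f p.1 p.2 := fun f =>
    (prod_sigma Γ (fun γ => (rcSetup d).ints γ) (fun p => f p.1 p.2)).symm
  simp_rw [hprod]
  rw [IntEdges_eq_biUnion_blocks, sum_powerset_biUnion_prod _ _ (pairwiseDisjoint_blocks hd hΓ)]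
  rfl

include hd in
/-- Every configuration of the volume lies in the fibre of its external family. [folklore] -/
theorem xc_mem_extFam (ω : Finset (Sym2 (Site d))) (hω : ω ∈ (freeEdges V).powerset) : xc σ V ω ∈ (rcSetup d).ExtFam σ V := by
  rw [xc_eq (mem_powerset.1 hω)]
  exact extContours_mem_extFam hd (mem_powerset.1 hω)

include hd hV in
/-- **The contour representation of the partition function** (FV (7.29), Grimmett (7.21)–(7.22)):
`Z^σ(V) = Σ_{Γ external family of type σ in V} w_σ^{|V ∖ ⋃ hull|} Π_{γ ∈ Γ} ( t^{e(γ)} q^{cwt(γ)} Π_A Z^{lab A}(A) )`.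
[cite: FriedliVelenik2017, §7.3, eqs. (7.29)–(7.30); Grimmett2006, §7.5, eqs. (7.21)–(7.22)] -/
theorem Zrc_eq_sum_extFam (t q : ℝ) (σ : Phase) :
    Zrc t q σ V = ∑ Γ ∈ (rcSetup d).ExtFam σ V, groundW d t q σ ^ #((rcSetup d).Wvol V Γ) *
      ∏ γ ∈ Γ, (t ^ γ.1.energy * q ^ γ.1.cwt * ∏ A ∈ (rcSetup d).ints γ, Zrc t q ((rcSetup d).lab γ A) A) := by
  classical
  rw [Zrc_eq_sum_wt, ← sum_fiberwise_of_maps_to (xc_mem_extFam hd (σ := σ) (V := V))]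
  exact sum_congr rfl fun Γ hΓ => sum_Fib_wt hd hV t q hΓ

include hd hV in
/-- **The weight of the configurations having a given external contour**: for `γ₀`,
`Σ_{ω : γ₀ external} wt ω = Σ_{Γ ∋ γ₀} (fibre sum of Γ)`. [cite: FriedliVelenik2017, §7.3.2, Lemma 7.26] -/
theorem sum_wt_filter_mem_xc (t q : ℝ) (σ : Phase) (γ₀ : (rcSetup d).Γ) :
    ∑ ω ∈ (freeEdges V).powerset with γ₀ ∈ xc σ V ω, wt t q σ V ω =
      ∑ Γ ∈ ((rcSetup d).ExtFam σ V).filter (fun Γ => γ₀ ∈ Γ), groundW d t q σ ^ #((rcSetup d).Wvol V Γ) *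
        ∏ γ ∈ Γ, (t ^ γ.1.energy * q ^ γ.1.cwt * ∏ A ∈ (rcSetup d).ints γ, Zrc t q ((rcSetup d).lab γ A) A) := by
  classical
  have hmaps : ∀ ω ∈ (freeEdges V).powerset.filter (fun ω => γ₀ ∈ xc σ V ω), xc σ V ω ∈ ((rcSetup d).ExtFam σ V).filter (fun Γ => γ₀ ∈ Γ) :=
    fun ω hω => mem_filter.2 ⟨xc_mem_extFam hd ω (mem_filter.1 hω).1, (mem_filter.1 hω).2⟩
  rw [← sum_fiberwise_of_maps_to hmaps]
  refine sum_congr rfl fun Γ hΓ => ?_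
  obtain ⟨hΓ, hγ₀⟩ := mem_filter.1 hΓ
  rw [← sum_Fib_wt hd hV t q hΓ]
  refine sum_congr ?_ fun _ _ => rfl
  ext ω
  simp only [Fib, mem_filter]
  constructor
  · rintro ⟨⟨h1, -⟩, h3⟩; exact ⟨h1, h3⟩
  · rintro ⟨h1, h3⟩; exact ⟨⟨h1, h3 ▸ hγ₀⟩, h3⟩

end Fibre

end RCC

end Literature.Probability.LatticeModels
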